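import Summits.BirchSwinnertonDyer.BirchSwinnertonDyer.Theorems.KatoDescentPotSupersingularWildLowerKimCerts
import HarnessLib

/-!
# Route `KatoDescentPotSupersingular` (rung K9): crux `WildLowerHalfRankZero` (L₀, item
# stmt-BirchSwinnertonDyer-19195) — the 3-SPLIT Kim lane along the class and the FOUR-LANE deep slot
# (`--supports` helper; seat bsd-potss-k9-c2, generation 4; companion of `…WildLowerKimCerts.lean`, p438045)

The companion file fills the DEEP slot of the certificate road with three refereed Kim lanes (t = 0 unit,
t = 0 index, t-uniform deep lane of depth `k ≥ 2 + t`). For the deep classes with `E(ℚ₃)[3] ≠ 0`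
(census: 402624cj1, 413559be1, 496584bv1, `#E(ℚ₃)[3] = #E(ℚ₃)[9] = 3`, kit j253516) the depth-3 levels are
huge (smallest cyclic pair products 237 817, 8.7·10⁷, 4.3·10⁶; kit j253358; the first gives `ord₃ δ̃ = 2`); the kim3 memo's §19
3-SPLIT lane `N11.KimAtThreeSplitCertPUB` (REF C17–C19 PASS) needs only depth `k ≥ 2` at levels where `3`
splits completely in the `3`-part of `ℚ(μ_n)` (`ord_ℓ(3)` prime to `3`), with NO `t`-binder and no
Tamagawa hypothesis, under the discriminant condition `Δ ∉ 3ℚ^{×3} ∪ 9ℚ^{×3}` (true on all three; smallest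
such cyclic pair for 496584bv1: `307·523 = 160 561`, kit j253476, where `δ̃ ≡ 0 (mod 9)`, kit j253516 — so
no `t = 1` deep class is certified on a refereed lane yet; the lanes are typed for the next engine). §1 types that lane along the class
(Cassels transport); §2 the crux BY NAME from generation 2's shallow slot and a FOUR-lane Kim certificate on
every deep class. Conditional on the refereed cell-memo names (`@[conjecture]` nodes, NOT Literature facts),
Cassels–Tate (shallow slot only), Cassels, GZK, modularity, and per-class certificate SLOTS; class-wide the
slots are Kurihara's conjecture ⟺ Kato's IMC at 3; the item is NOT closed; BSD is not proved by any of this.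

References: [Kim2025RefinedTNC] Thm. 1.1; [Kim2022StructureSelmer] Thm. 1.9 (6), Thm. 3.11; [MazurRubin2004]
Cor. 4.5.2; [MilneADT2006] Thm. I.7.3; [SilvermanAEC2009] Thm. X.4.14; [Miller2011LMS] Def. 1.1; memo
`run/shared/lean/pub/bsd-addord/kim3/KIM3-PROOF.md` §19.
-/

set_option autoImplicit false
-- sibling precedent (`KatoDescentPotSupersingularAssembly.lean`): the directory name repeats the summit name
set_option linter.dupNamespace false

noncomputable section

open scoped Classical
namespace Summit.BirchSwinnertonDyer.BirchSwinnertonDyer.Theorems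

open WeierstrassCurve Literature.NumberTheory.EllipticCurves
  Literature.NumberTheory.EllipticCurves.ModularForms
  Literature.NumberTheory.EllipticCurves.Rank1Residual
  Literature.NumberTheory.EllipticCurves.Rank1Residual.Typed
  Summit.BirchSwinnertonDyer.Rank1Residual.Additive
  Summit.BirchSwinnertonDyer.Rank1Residual
  Summit.BirchSwinnertonDyer.BirchSwinnertonDyer.Theses.KatoDescentPotSupersingular

/-! ## §1 The 3-split Kim lane along the class -/

/-- **The 3-SPLIT lane along the class** (any `t`, no Tamagawa hypothesis; kim3 memo §19 as the name
`N11.KimAtThreeSplitCertPUB`): a globally minimal member `W'` with the `3`-adic tower onto,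
`Δ(W') ∉ 3ℚ^{×3} ∪ 9ℚ^{×3}`, a datum with the period transfer, and ONE unit mod-3 Kurihara number at a cyclic
Kolyvagin level `n ∈ 𝒩_k`, `k ≥ 2`, at which `3` splits completely in the `3`-part of `ℚ(μ_n)`, gives L₀ at
`W'` (`N11.missingLowerBoundAt_three_of_kimAtThreeSplitCertPUB_of_unit`), moved to `W` by Cassels'
transport. Census: the slot of the three `t = 1` deep classes; the one computable level (496584bv1,
`n = 307·523`, kit j253516) has `δ̃_n ≡ 0 (mod 9)` — no certificate yet. Conditional; nothing credited.
[cite: Kim2022StructureSelmer, Thm. 1.9 (6) and Thm. 3.11] [cite: MazurRubin2004, Cor. 4.5.2]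
[cite: MilneADT2006, Thm. I.7.3] [cite: Miller2011LMS, Def. 1.1] -/
theorem missingLowerBoundAt_wild_of_isIsogenous_kimSplitUnitCert (hKs : N11.KimAtThreeSplitCertPUB)
    (hCassels : bsdRHS_eq_of_isIsogenous) (hGZK : rank_eq_analyticRank_of_analyticRank_le_one)
    (hmod : hasEntireLFunction_rat)
    (W : WeierstrassCurve ℚ) [W.IsElliptic] [W.IsGloballyMinimal] [Fact (3 : ℕ).Prime]
    (hr : W.analyticRank = 0) (_hO : ClassO6 W 3)
    (W' : WeierstrassCurve ℚ) [W'.IsElliptic] [W'.IsGloballyMinimal] (hiso : IsIsogenous W W')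
    (htower : ∀ n : ℕ, W'.HasSurjectiveModNGaloisRep (3 ^ n : ℕ))
    (hΔ : ¬ ∃ c : ℚ, W'.Δ = 3 * c ^ 3 ∨ W'.Δ = 9 * c ^ 3)
    {N : ℕ} [NeZero N] (D : ModularParametrizationData W' N)
    (hper : ∃ u : ℚ, ‖(u : ℚ_[3])‖ = 1 ∧ W'.realPeriodRat = u * plusPeriod D.f)
    {k n : ℕ} [NeZero n] (hk : 2 ≤ k) (hn : Kato.IsKolyvaginProduct W' 3 k n)
    (hcyc : ∀ (ℓ : ℕ) [Fact ℓ.Prime], ℓ ∣ n →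
      Nat.card {P : ((WeierstrassCurve.integralModelInt W').map
          (Int.castRingHom (ZMod ℓ))).toAffine.Point // 3 • P = 0} ≤ 3)
    (hspl : ∀ ℓ ∈ n.primeFactors, Nat.Coprime (orderOf (3 : ZMod ℓ)) 3)
    (ψ : (ℓ : ℕ) → (ZMod ℓ)ˣ →* Multiplicative (ZMod (3 ^ 1)))
    (hψ : ∀ ℓ ∈ n.primeFactors, Function.Surjective (ψ ℓ))
    (hδ : kuriharaNumber D.f (3 ^ 1) n ψ ≠ 0) : MissingLowerBoundAt W 3 := by
  have hr' : W'.analyticRank = 0 := by rw [← analyticRank_eq_of_isIsogenous' hiso, hr]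
  have hL' : W'.entireLFunction 1 ≠ 0 := (W'.analyticRank_eq_zero_iff_holds (hmod W')).mp hr'
  have hr1 : W'.analyticRank ≤ 1 := by rw [hr']; exact zero_le_one
  have hlow : MissingLowerBoundAt W' 3 :=
    N11.missingLowerBoundAt_three_of_kimAtThreeSplitCertPUB_of_unit W' hKs hGZK htower hL' hΔ D hper hk hn
      hcyc hspl ψ hψ hδ
  exact TwistComparison.missingLowerBoundAt_of_isIsogenous W' W 3 hCassels hGZK hmod
    hiso.symm_of_charZero hr1 hlow

/-! ## §2 The crux BY NAME: shallow witnesses + a four-lane Kim certificate on every deep class -/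

/-- **`WildLowerHalfRankZero` from the published inputs, generation 2's SHALLOW witness slot, and a
FOUR-LANE Kim certificate on every DEEP class**: as `wildLowerHalfRankZero_of_shallowWitnesses_of_kimDeepCerts`
(p438045) with a fourth refereed disjunct (d) — the 3-SPLIT lane of §1 (`Δ ∉ 3ℚ^{×3} ∪ 9ℚ^{×3}`, a unit
mod-3 Kurihara number at a cyclic 3-split level of depth `k ≥ 2`). Census (kit j253114 / j253192 / j253420 /
j253516): (a) on 7 deep classes, (b) on 422253b1 (`δ̃⁽²⁾ ≡ 6, 3 (mod 9)` at `109·307`, `109·829`); (c)/(d) are the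
slots of the three `t = 1` classes 402624cj1 / 413559be1 / 496584bv1 — NOT instantiated: the single computable
levels give `ord₃ δ̃ = 2` (402624cj1, `163·1459`, depth 3) and `≥ 2` (496584bv1, `307·523`, split), the other
levels exceed `5·10⁵`. HONEST LABEL: per-pair roads made uniform by hypothesis; class-wide `hwit ∧ hkim` is the crux's
content. Conditional; the item is NOT closed. [cite: Kim2025RefinedTNC, Thm. 1.1/1.2]
[cite: Kim2022StructureSelmer, Thm. 1.9 (6)] [cite: SilvermanAEC2009, Thm. X.4.14] [cite: MilneADT2006, Thm. I.7.3]
[cite: Miller2011LMS, Def. 1.1] -/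
theorem wildLowerHalfRankZero_of_shallowWitnesses_of_kimFourLaneCerts
    (hCT : exists_casselsTate_pairing (K := ℚ)) (hCassels : bsdRHS_eq_of_isIsogenous)
    (hGZK : rank_eq_analyticRank_of_analyticRank_le_one) (hmod : hasEntireLFunction_rat)
    (hKim : N11.KimAtThreeRankZeroPUB) (hKd : N11.KimAtThreeDeepCertPUB) (hKs : N11.KimAtThreeSplitCertPUB)
    (hwit : ∀ (W : WeierstrassCurve ℚ) [W.IsElliptic] [W.IsGloballyMinimal] [Fact (3 : ℕ).Prime],
      W.analyticRank = 0 → ClassO6 W 3 →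
      (∀ (W' : WeierstrassCurve ℚ) [W'.IsElliptic] [W'.IsGloballyMinimal], IsIsogenous W W' →
        ∀ q' : ℚ, shaAn W' = (q' : ℂ) → 0 < padicValRat 3 q') →
      (∃ (W' : WeierstrassCurve ℚ) (_ : W'.IsElliptic) (_ : W'.IsGloballyMinimal),
        IsIsogenous W W' ∧ ∃ q' : ℚ, shaAn W' = (q' : ℂ) ∧ padicValRat 3 q' ≤ 2) →
      ∃ (W' : WeierstrassCurve ℚ) (_ : W'.IsElliptic) (_ : W'.IsGloballyMinimal),
        IsIsogenous W W' ∧ ∃ q' : ℚ, shaAn W' = (q' : ℂ) ∧ padicValRat 3 q' ≤ 2 ∧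
          ∃ x : W'.sha, x ≠ 0 ∧ 3 • x = 0)
    (hkim : ∀ (W : WeierstrassCurve ℚ) [W.IsElliptic] [W.IsGloballyMinimal] [Fact (3 : ℕ).Prime],
      W.analyticRank = 0 → ClassO6 W 3 →
      (∀ (W' : WeierstrassCurve ℚ) [W'.IsElliptic] [W'.IsGloballyMinimal], IsIsogenous W W' →
        ∀ q' : ℚ, shaAn W' = (q' : ℂ) → 2 < padicValRat 3 q') →
      ∃ (W' : WeierstrassCurve ℚ) (_ : W'.IsElliptic) (_ : W'.IsGloballyMinimal),
        IsIsogenous W W' ∧ (∀ n : ℕ, W'.HasSurjectiveModNGaloisRep (3 ^ n : ℕ)) ∧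
        ∃ (N : ℕ) (_ : NeZero N) (D : ModularParametrizationData W' N),
          (∃ u : ℚ, ‖(u : ℚ_[3])‖ = 1 ∧ W'.realPeriodRat = u * plusPeriod D.f) ∧
          ((Nat.card {Q : (W'.baseChange ℚ_[3]).toAffine.Point // (3 : ℕ) • Q = 0} = 1 ∧
              ¬ 3 ∣ W'.tamagawaProduct ∧ X4.KuriharaUnitAt W' 3 D.f) ∨
            (Nat.card {Q : (W'.baseChange ℚ_[3]).toAffine.Point // (3 : ℕ) • Q = 0} = 1 ∧
              ¬ (3 : ℤ) ∣ D.maninConstant ∧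
              ∃ (k n : ℕ) (_ : NeZero n), 1 ≤ k ∧ Kato.IsKolyvaginProduct W' 3 k n ∧
                (∀ (ℓ : ℕ) [Fact ℓ.Prime], ℓ ∣ n →
                  Nat.card {P : ((WeierstrassCurve.integralModelInt W').map
                      (Int.castRingHom (ZMod ℓ))).toAffine.Point // 3 • P = 0} ≤ 3) ∧
                ∃ ψ : (ℓ : ℕ) → (ZMod ℓ)ˣ →* Multiplicative (ZMod (3 ^ k)),
                  (∀ ℓ ∈ n.primeFactors, Function.Surjective (ψ ℓ)) ∧
                  kuriharaNumber D.f (3 ^ k) n ψ ≠ 0 ∧ k - 1 ≤ padicValNat 3 W'.tamagawaProduct) ∨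
            (∃ (t k n : ℕ) (_ : NeZero n),
              Nat.card {Q : (W'.baseChange ℚ_[3]).toAffine.Point // (9 : ℕ) • Q = 0} ≤ 3 ^ t ∧
              2 + t ≤ k ∧ Kato.IsKolyvaginProduct W' 3 k n ∧
              (∀ (ℓ : ℕ) [Fact ℓ.Prime], ℓ ∣ n →
                Nat.card {P : ((WeierstrassCurve.integralModelInt W').map
                    (Int.castRingHom (ZMod ℓ))).toAffine.Point // 3 • P = 0} ≤ 3) ∧
              ∃ ψ : (ℓ : ℕ) → (ZMod ℓ)ˣ →* Multiplicative (ZMod (3 ^ 1)),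
                (∀ ℓ ∈ n.primeFactors, Function.Surjective (ψ ℓ)) ∧
                kuriharaNumber D.f (3 ^ 1) n ψ ≠ 0) ∨
            ((¬ ∃ c : ℚ, W'.Δ = 3 * c ^ 3 ∨ W'.Δ = 9 * c ^ 3) ∧
              ∃ (k n : ℕ) (_ : NeZero n), 2 ≤ k ∧ Kato.IsKolyvaginProduct W' 3 k n ∧
                (∀ (ℓ : ℕ) [Fact ℓ.Prime], ℓ ∣ n →
                  Nat.card {P : ((WeierstrassCurve.integralModelInt W').map
                      (Int.castRingHom (ZMod ℓ))).toAffine.Point // 3 • P = 0} ≤ 3) ∧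
                (∀ ℓ ∈ n.primeFactors, Nat.Coprime (orderOf (3 : ZMod ℓ)) 3) ∧
                ∃ ψ : (ℓ : ℕ) → (ZMod ℓ)ˣ →* Multiplicative (ZMod (3 ^ 1)),
                  (∀ ℓ ∈ n.primeFactors, Function.Surjective (ψ ℓ)) ∧
                  kuriharaNumber D.f (3 ^ 1) n ψ ≠ 0))) :
    Summit.BirchSwinnertonDyer.BirchSwinnertonDyer.Theses.KatoDescentPotSupersingular.WildLowerHalfRankZero :=
  wildLowerHalfRankZero_of_shallowWitnesses_of_deepRows hCT hCassels hGZK hmod hwit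
    fun W _ _ _ hr hO hdeepRow ↦ by
      obtain ⟨W', hW', hM', hiso, htower, N, hN, D, hper, hcert⟩ := hkim W hr hO hdeepRow
      haveI := hW'
      haveI := hM'
      haveI := hN
      rcases hcert with ⟨ht0, htam, hKu⟩ | ⟨ht0, hc, k, n, hn0, hk, hn, hcyc, ψ, hψ, hδ, hkt⟩ |
          ⟨t, k, n, hn0, ht, hk, hn, hcyc, ψ, hψ, hδ⟩ | ⟨hΔ, k, n, hn0, hk, hn, hcyc, hspl, ψ, hψ, hδ⟩
      · exact missingLowerBoundAt_wild_of_isIsogenous_kimUnitCert hKim hCassels hGZK hmod W hr hO W' hiso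
          htower ht0 D hper htam hKu
      · haveI := hn0
        exact missingLowerBoundAt_wild_of_isIsogenous_kimIndexCert hKim hCassels hGZK hmod W hr hO W' hiso
          htower ht0 D hc hper hk hn hcyc ψ hψ hδ hkt
      · haveI := hn0
        exact missingLowerBoundAt_wild_of_isIsogenous_kimDeepUnitCert hKd hCassels hGZK hmod W hr hO W'
          hiso htower D hper ht hk hn hcyc ψ hψ hδ
      · haveI := hn0
        exact missingLowerBoundAt_wild_of_isIsogenous_kimSplitUnitCert hKs hCassels hGZK hmod W hr hO W'
          hiso htower hΔ D hper hk hn hcyc hspl ψ hψ hδ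

end Summit.BirchSwinnertonDyer.BirchSwinnertonDyer.Theorems

end
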